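import Summits.BirchSwinnertonDyer.Rank1Residual.X11b.Three.GoodReductionSubgroupNodeFrobenius
import HarnessLib

/-!
# X11b at `p = 3` (team N8/O2), JET3-KUMMER (α), the `Ẽ_ns` half at an ADDITIVE place:
# the cusp reduction map `r : E₀(L) → k⁺` and its Galois behaviour (equivariant through the
# residue field), in p1's `JetchevKummerAtP` dictionary

HONEST FRAMING (cell `b2b-bsdres`, run/shared/lean/b2b/bsd-rank1-residual/, verbatim in every
file): the goal of the cell is to DELETE the COMBINATION-SHAPED residual classes of the
Birch–Swinnerton-Dyer formula for ALL analytic-rank `≤ 1` elliptic curves over `ℚ` — "full BSD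
formula for every rank `≤ 1` curve in class `C`" assembled STRICTLY from published theorems — so
that the rank-`≤ 1` remainder becomes exactly the CONSTRUCTION-SHAPED classes, which are TYPED
(missing-input `Prop`s), NOT attempted. This is not "finishing BSD". Team N8/O2 = `x11b3`, seat
`b2b-bsdres-x11b3-p4` (owner of record of the S15 interface, LEAD DEAL #7 R7-7), S15 (v) "(α) at
ADDITIVE places" (offered 2026-08-21T08:24Z), part 12. THEOREMS ONLY: no definition, no named
fact, no `sorry`; nothing is booked; `JET@p|N` NOT discharged.

## Why

p1's JET3-KUMMER chain (`Three/KolyvaginClassBadPlace.lean`, Gross 1991 Prop. 6.2 (1) /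
Jetchev 2008 Prop. 4.1) takes the local input (α) `H¹(Gal(L_w/K_v), E₀(L_w)) = 0` at EVERY bad
place `v ∣ N`, of ANY reduction type (Milne, *ADT* I Prop. 3.8: `H¹(k, 𝒜°) = 0`, Lang + Hensel).
S15 (parts 1–11, p3 (ii), p8 (iii)) discharges it at MULTIPLICATIVE places. The class
`ClassX11b W 3 = (r_an = 1) ∧ Mult W 3 ∧ Irr W 3` allows ADDITIVE primes `ℓ ≠ 3` (`ℓ² ∣ N`). At an
additive place the special fibre's smooth locus is `Ẽ_ns ≅ 𝔾_a` (a CUSP; Silverman *AEC*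
III.2.5(b)), and (α) splits as before into the formal-group half (`h1ker_of_adicComplete`,
part 11 — reduction-type agnostic) and an `Ẽ_ns` half, which is now ADDITIVE Hilbert 90 on `k`
(part 7) once the cusp reduction map and its Galois behaviour are available. This file supplies
those two ingredients; part 13 (`GoodReductionSubgroupCuspH1`) assembles.

## What

* §1 **`exists_addMonoidHom_of_map_eq_singularModel_cusp`** — for a Weierstrass equation `W`
  over a local ring `R ⊆ K` (`hv : v.Integers R`) whose reduction is a PRESENTED CUSP
  `W̃ = singularModel x₀ y₀ α α` over the residue field `k`: the composite of the reduction
  homomorphism `E₀(K) → Ẽ_ns(k)` (*AEC* VII.2.1; tree `reductionHom`) with Silverman's cusp map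
  `(x, y) ↦ (x − x₀)/(y − y₀ − α(x − x₀)) : Ẽ_ns(k) ≅ k⁺` (*AEC* III.2.5(b); tree `cuspHom`) is a
  homomorphism `r : E₀(K) →+ k` with kernel exactly `E₁(K)` and given on integral points with
  nonsingular reduction by `r(a, b) = cuspFun(ā, b̄)` — the cusp twin of the tree's
  `exists_addMonoidHom_units_of_map_eq_singularModel` (`NodeReductionMapProofs`).
* §2 **`exists_residueMap_cuspReduction_smul`** — in p1's dictionary (`X / F`, `L ⊇ F`, abstract
  DVR `R` with `Frac R = L`, every `τ ∈ Aut(L/F)` preserving `R`, `R`-model `W₀` with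
  `X ⊗ L = W₀ ⊗ L` and `W₀ mod 𝔪 = singularModel x₀ y₀ α α`): for `σ ∈ Aut(L/F)` there is
  `σ̄ : k →+* k` with `σ̄ ā = \overline{σ a}`; `E₀` is `σ`-stable; `σ̄` fixes `x₀, y₀, α`; and
  **`r(σ • P) = σ̄ (r P)`** for all `P ∈ E₀` — EQUIVARIANT, with no `±` twist (the cusp and its
  double tangent are rational over the residue field of `K_v`: `singularModel.apply_eq_of_map_eq`
  with `α₁ = α₂`). Same mechanism as part 4 (`exists_residueMap_nodeReduction_smul`).

References (locators only; no new fact): [cite: SilvermanAEC2009, Prop. III.2.5(b) (PDF p. 59),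
VII.2 Prop. 2.1 (PDF p. 167), Exercise 3.5] [cite: MilneADT2006, Ch. I Prop. 3.8]
[cite: NeukirchANT1999, Ch. II §9].

## Design

No definitions; `noncomputable section`; `open scoped Classical`; universe `u` for `F`, `L`; the
map `r` and the residue endomorphism are produced existentially with their defining properties.
Axioms: `propext`, `Classical.choice`, `Quot.sound`.
-/

noncomputable section

open scoped Classical

namespace Summit.BirchSwinnertonDyer.Rank1Residual.X11b.Three.JetchevKummer

open WeierstrassCurve Literature.NumberTheory.EllipticCurves

universe u

/-! ### §1 The cusp reduction map `E₀(K) → k⁺` with kernel `E₁(K)` and its formula -/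

section CuspMap

variable {K : Type*} [Field K] {Γ₀ : Type*} [LinearOrderedCommGroupWithZero Γ₀]
  {v : Valuation K Γ₀} {R : Type*} [CommRing R] [IsLocalRing R] [Algebra R K]
  (W : WeierstrassCurve R)

/-- **Additive reduction, explicitly: `E₀(K) → k⁺` through the cusp map.** Let `W` be a
Weierstrass equation over a valuation ring `R` of `K` (`hv : v.Integers R`) whose reduction is a
cusp presented as a singular model, `W̃ = singularModel x₀ y₀ α α` over the residue field `k`.
Then the composite of the reduction homomorphism `E₀(K) → Ẽ_ns(k)` (Silverman, *AEC* VII.2.1;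
`reductionHom`) with Silverman's cusp map `(x, y) ↦ (x − x₀)/(y − y₀ − α(x − x₀)) : Ẽ_ns(k) ≅ k⁺`
(*AEC* III.2.5(b); `singularModel.cuspHom`) is a homomorphism `r : E₀(K) →+ k` with kernel exactly
`E₁(K)` and given on the points with integral coordinates and nonsingular reduction by
`r(a, b) = cuspFun(ā, b̄)` (on `E₁(K)` it is `0`).
[cite: SilvermanAEC2009, VII.2 Prop. 2.1 and Prop. III.2.5(b) (PDF pp. 167, 59)] -/
theorem exists_addMonoidHom_of_map_eq_singularModel_cusp (hv : v.Integers R)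
    {x₀ y₀ α : IsLocalRing.ResidueField R}
    (hW : W.map (IsLocalRing.residue R) = singularModel x₀ y₀ α α) :
    ∃ r : W.nonsingularReductionSubgroup hv →+ IsLocalRing.ResidueField R,
      (∀ P : W.nonsingularReductionSubgroup hv,
          r P = 0 ↔ W.ReducesToZero (P : (W.baseChange K).toAffine.Point)) ∧
      ∀ (a b : R) (h : (W.baseChange K).toAffine.Nonsingular (algebraMap R K a) (algebraMap R K b))
        (hns : (singularModel x₀ y₀ α α).toAffine.Nonsingular (IsLocalRing.residue R a)
          (IsLocalRing.residue R b))
        (hP : W.HasNonsingularReduction (.some _ _ h)),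
        r ⟨.some _ _ h, hP⟩ = singularModel.cuspFun x₀ y₀ α (.some _ _ hns) := by
  let e := Affine.Point.congrEquiv hW
  let r : W.nonsingularReductionSubgroup hv →+ IsLocalRing.ResidueField R :=
    (singularModel.cuspHom x₀ y₀ α).comp (e.toAddMonoidHom.comp (W.reductionHom hv))
  have hr : ∀ P : W.nonsingularReductionSubgroup hv,
      r P = singularModel.cuspHom x₀ y₀ α
        (e (W.reducePoint (P : (W.baseChange K).toAffine.Point))) := fun _ ↦ rfl
  refine ⟨r, fun P ↦ ?_, fun a b h hns hP ↦ ?_⟩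
  · rw [hr, ← reducePoint_eq_zero_iff hv P.2, ← (singularModel.cuspHom x₀ y₀ α).map_zero,
      singularModel.cuspHom_injective.eq_iff, e.map_eq_zero_iff]
  · have hns' : (W.map (IsLocalRing.residue R)).toAffine.Nonsingular (IsLocalRing.residue R a)
        (IsLocalRing.residue R b) := by rw [hW]; exact hns
    rw [hr, reducePoint_some_algebraMap hv.hom_inj h hns', singularModel.cuspHom_apply]
    change singularModel.cuspFun x₀ y₀ α (Affine.Point.congrEquiv hW (.some _ _ hns')) = _
    rw [Affine.Point.congrEquiv_some]

end CuspMap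

/-! ### §2 The decomposition group acts on the cusp reduction map through the residue field -/

section Galois

variable {F : Type u} [Field F] (X : WeierstrassCurve F) (L : Type u) [Field L] [Algebra F L]
  (R : Type*) [CommRing R] [IsDomain R] [IsDiscreteValuationRing R] [Algebra R L]
  [IsFractionRing R L] (W₀ : WeierstrassCurve R) (hX : X.baseChange L = W₀.baseChange L)

/-- **The cusp map commutes with ring homomorphisms**:
`cuspFun_{f x₀, f y₀, f α}(f x, f y) = f (cuspFun_{x₀, y₀, α}(x, y))`. With `f` an endomorphism
fixing the three parameters this is the equivariance of the cusp map (Silverman, *AEC*,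
Prop. III.2.5(b)). [cite: SilvermanAEC2009, Prop. III.2.5(b) (PDF p. 59)] -/
theorem cuspFun_map_some {k : Type*} [Field k] (f : k →+* k) {x₀ y₀ α x y : k}
    (h : (singularModel x₀ y₀ α α).toAffine.Nonsingular x y)
    (h' : (singularModel (f x₀) (f y₀) (f α) (f α)).toAffine.Nonsingular (f x) (f y)) :
    singularModel.cuspFun (f x₀) (f y₀) (f α) (.some _ _ h') =
      f (singularModel.cuspFun x₀ y₀ α (.some _ _ h)) := by
  simp only [singularModel.cuspFun, map_div₀, map_sub, map_mul]

include hX in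
/-- **An automorphism preserving `R` acts on `r = cuspFun ∘ reduction` through the residue field,
equivariantly.** Let `X / F`, `L ⊇ F` with discrete valuation ring `R` (`Frac R = L`) such that
every `τ ∈ Aut(L/F)` maps `R` into `R` (`hR`), `W₀` an `R`-model of `X ⊗ L` (`hX`) whose reduction
is a presented cusp `W̃₀ = singularModel x₀ y₀ α α` over the residue field `k` (`hW`), and
`r : E₀ →+ k` a homomorphism with kernel `E₁` (`hr0`) given on integral points by
`r(a, b) = cuspFun(ā, b̄)` (`hr`; such an `r` is `exists_addMonoidHom_of_map_eq_singularModel_cusp`).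
Then for `σ ∈ Aut(L/F)` there is a ring endomorphism `σ̄` of `k` with `σ̄ ā = \overline{σ a}`
(`a ∈ R`), `E₀` is `σ`-stable, `σ̄` fixes `x₀, y₀, α`, and `r(σ • P) = σ̄ (r P)` for all
`P ∈ E₀` (the cusp `S = (x₀, y₀)` is the unique singular point of `W̃₀ = σ̄ W̃₀` and `α` its unique
tangent slope). [cite: SilvermanAEC2009, Prop. III.2.5(b), Prop. III.1.4(a), VII.2 Prop. 2.1]
[cite: NeukirchANT1999, Ch. II §9] -/
theorem exists_residueMap_cuspReduction_smul
    (hR : ∀ (τ : L ≃ₐ[F] L) (x : L), x ∈ Set.range (algebraMap R L) →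
      τ x ∈ Set.range (algebraMap R L))
    (σ : L ≃ₐ[F] L) {x₀ y₀ α : IsLocalRing.ResidueField R}
    (hW : W₀.map (IsLocalRing.residue R) = singularModel x₀ y₀ α α)
    (r : W₀.nonsingularReductionSubgroup (integers_valuationRing_valuation R L) →+
      IsLocalRing.ResidueField R)
    (hr0 : ∀ P : W₀.nonsingularReductionSubgroup (integers_valuationRing_valuation R L),
      r P = 0 ↔ W₀.ReducesToZero (P : (W₀.baseChange L).toAffine.Point))
    (hr : ∀ (a b : R)
      (h : (W₀.baseChange L).toAffine.Nonsingular (algebraMap R L a) (algebraMap R L b))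
      (hns : (singularModel x₀ y₀ α α).toAffine.Nonsingular (IsLocalRing.residue R a)
        (IsLocalRing.residue R b))
      (hP : W₀.HasNonsingularReduction (.some _ _ h)),
      r ⟨.some _ _ h, hP⟩ = singularModel.cuspFun x₀ y₀ α (.some _ _ hns)) :
    ∃ σk : IsLocalRing.ResidueField R →+* IsLocalRing.ResidueField R,
      (∀ a a' : R, algebraMap R L a' = σ (algebraMap R L a) →
        σk (IsLocalRing.residue R a) = IsLocalRing.residue R a') ∧
      (∀ P : (X.baseChange L).toAffine.Point,
        W₀.HasNonsingularReduction (Affine.Point.congrEquiv hX P) →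
          W₀.HasNonsingularReduction (Affine.Point.congrEquiv hX (σ • P))) ∧
      σk x₀ = x₀ ∧ σk y₀ = y₀ ∧ σk α = α ∧
      ∀ (P : (X.baseChange L).toAffine.Point)
        (hP : W₀.HasNonsingularReduction (Affine.Point.congrEquiv hX P))
        (hσP : W₀.HasNonsingularReduction (Affine.Point.congrEquiv hX (σ • P))),
        r ⟨_, hσP⟩ = σk (r ⟨_, hP⟩) := by
  have hv := integers_valuationRing_valuation R L
  have hinj : Function.Injective (algebraMap R L) := IsFractionRing.injective R L
  -- `σ` restricted to `R`: a local endomorphism (its inverse `σ⁻¹` also preserves `R`)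
  have hex : ∀ a : R, ∃ a' : R, algebraMap R L a' = σ (algebraMap R L a) := fun a ↦ by
    obtain ⟨a', ha'⟩ := hR σ (algebraMap R L a) ⟨a, rfl⟩
    exact ⟨a', ha'⟩
  choose f hf using hex
  let σR : R →+* R :=
    { toFun := f
      map_one' := hinj (by simp only [hf, map_one])
      map_mul' := fun a b ↦ hinj (by simp only [hf, map_mul])
      map_zero' := hinj (by simp only [hf, map_zero])
      map_add' := fun a b ↦ hinj (by simp only [hf, map_add]) }
  have hσR : ∀ a : R, algebraMap R L (σR a) = σ (algebraMap R L a) := hf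
  haveI : IsLocalHom σR := by
    refine ⟨fun a ha ↦ ?_⟩
    obtain ⟨b, hb⟩ := isUnit_iff_exists_inv.mp ha
    obtain ⟨b', hb'⟩ := hR σ⁻¹ (algebraMap R L b) ⟨b, rfl⟩
    refine isUnit_iff_exists_inv.mpr ⟨b', hinj ?_⟩
    rw [map_mul, map_one, hb']
    have h1 : σ (algebraMap R L a) * algebraMap R L b = 1 := by
      rw [← hσR, ← map_mul, hb, map_one]
    have h2 := congrArg (σ⁻¹ : L ≃ₐ[F] L) h1
    rw [map_mul, map_one] at h2
    rwa [show (σ⁻¹ : L ≃ₐ[F] L) (σ (algebraMap R L a)) = algebraMap R L a from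
      σ.symm_apply_apply _] at h2
  set σk : IsLocalRing.ResidueField R →+* IsLocalRing.ResidueField R :=
    IsLocalRing.ResidueField.map σR with hσkdef
  have hσk : ∀ a : R, σk (IsLocalRing.residue R a) = IsLocalRing.residue R (σR a) := fun a ↦
    IsLocalRing.ResidueField.map_residue σR a
  -- `σ` fixes the coefficients of `W₀` (they come from `F`), so `σ̄` fixes the reduction
  have hcoef : ∀ {c : R} {x : F}, algebraMap F L x = algebraMap R L c → σR c = c := by
    intro c x hcx
    exact hinj (by rw [hσR, ← hcx, AlgEquiv.commutes])
  have hWσ : W₀.map σR = W₀ := by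
    have h1 := congrArg WeierstrassCurve.a₁ hX
    have h2 := congrArg WeierstrassCurve.a₂ hX
    have h3 := congrArg WeierstrassCurve.a₃ hX
    have h4 := congrArg WeierstrassCurve.a₄ hX
    have h6 := congrArg WeierstrassCurve.a₆ hX
    simp only [baseChange, map_a₁, map_a₂, map_a₃, map_a₄, map_a₆] at h1 h2 h3 h4 h6
    ext
    · exact hcoef h1
    · exact hcoef h2
    · exact hcoef h3
    · exact hcoef h4
    · exact hcoef h6
  have hWk : (singularModel x₀ y₀ α α).map σk = singularModel x₀ y₀ α α := by
    rw [← hW, map_map, hσkdef, IsLocalRing.ResidueField.map_comp_residue, ← map_map, hWσ]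
  obtain ⟨hx₀, hy₀, hslopes⟩ := singularModel.apply_eq_of_map_eq hWk
  have hα : σk α = α := by
    rcases hslopes with ⟨h₁, -⟩ | ⟨h₁, -⟩ <;> exact h₁
  -- residues of `σ`-moved integers
  have hσres : ∀ a a' : R, algebraMap R L a' = σ (algebraMap R L a) →
      σk (IsLocalRing.residue R a) = IsLocalRing.residue R a' := by
    intro a a' h
    rw [hσk, show σR a = a' from hinj (by rw [hσR, h])]
  -- the moved point, on coordinates
  have hsmul : ∀ {x y : L} (h : (X.baseChange L).toAffine.Nonsingular x y),
      ∃ h' : (X.baseChange L).toAffine.Nonsingular (σ x) (σ y), σ • (Affine.Point.some x y h) =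
        .some _ _ h' := by
    intro x y h
    rw [WeierstrassCurve.smul_def, Affine.Point.map_some]
    exact ⟨_, rfl⟩
  have hmove : ∀ {x y : L} (h : (X.baseChange L).toAffine.Nonsingular x y),
      ∃ h' : (W₀.baseChange L).toAffine.Nonsingular (σ x) (σ y),
        Affine.Point.congrEquiv hX (σ • (Affine.Point.some x y h)) = .some _ _ h' := by
    intro x y h
    obtain ⟨h₁, hh₁⟩ := hsmul h
    rw [hh₁, Affine.Point.congrEquiv_some]
    exact ⟨_, rfl⟩
  have hfix : ∀ {x y : L} (h : (X.baseChange L).toAffine.Nonsingular x y),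
      ∃ h' : (W₀.baseChange L).toAffine.Nonsingular x y,
        Affine.Point.congrEquiv hX (.some x y h) = .some _ _ h' := by
    intro x y h
    rw [Affine.Point.congrEquiv_some]
    exact ⟨_, rfl⟩
  -- integral points: reduction of `(a, b)` and of `(σ a, σ b)`
  have hns_iff : ∀ {a b : R}
      (h : (W₀.baseChange L).toAffine.Nonsingular (algebraMap R L a) (algebraMap R L b)),
      W₀.HasNonsingularReduction (.some _ _ h) ↔
        (singularModel x₀ y₀ α α).toAffine.Nonsingular (IsLocalRing.residue R a)
          (IsLocalRing.residue R b) := by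
    intro a b h
    rw [hasNonsingularReduction_some_algebraMap_iff hinj h, hW]
  -- a non-integral `x` stays non-integral under `σ` (`σ⁻¹` preserves `R`)
  have hnonint : ∀ {x : L}, x ∉ Set.range (algebraMap R L) → σ x ∉ Set.range (algebraMap R L) := by
    intro x hx hσx
    apply hx
    obtain ⟨c, hc⟩ := hR σ⁻¹ (σ x) hσx
    exact ⟨c, by rw [hc]; exact σ.symm_apply_apply x⟩
  -- integral coordinates: `x = a`, `y = b`, `σ x = σR a`, `σ y = σR b`
  have hint : ∀ {x y : L}, (W₀.baseChange L).toAffine.Nonsingular x y →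
      x ∈ Set.range (algebraMap R L) →
        ∃ a b : R, algebraMap R L a = x ∧ algebraMap R L b = y ∧
          algebraMap R L (σR a) = σ x ∧ algebraMap R L (σR b) = σ y := by
    rintro x y h ⟨a, rfl⟩
    have hy : ValuationRing.valuation R L y ≤ 1 :=
      v_Y_le_one_of_v_X_le_one hv h.1 (hv.map_le_one a)
    obtain ⟨b, rfl⟩ := hv.exists_of_le_one hy
    exact ⟨a, b, rfl, rfl, hσR a, hσR b⟩
  -- the image `(σ̄ ā, σ̄ b̄)` of a nonsingular point of the cusp is nonsingular
  have hσns_of : ∀ {a b : R},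
      (singularModel x₀ y₀ α α).toAffine.Nonsingular (IsLocalRing.residue R a)
        (IsLocalRing.residue R b) →
      (singularModel x₀ y₀ α α).toAffine.Nonsingular (IsLocalRing.residue R (σR a))
        (IsLocalRing.residue R (σR b)) := by
    intro a b hns
    have hσns := singularModel.nonsingular_map σk hns
    rw [hx₀, hy₀, hα, hσk, hσk] at hσns
    exact hσns
  -- `E₀` is `σ`-stable
  have hstable : ∀ P : (X.baseChange L).toAffine.Point,
      W₀.HasNonsingularReduction (Affine.Point.congrEquiv hX P) →
        W₀.HasNonsingularReduction (Affine.Point.congrEquiv hX (σ • P)) := by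
    intro P hP
    rcases P with _ | ⟨x, y, h⟩
    · rw [show (Affine.Point.zero : (X.baseChange L).toAffine.Point) = 0 from rfl, smul_zero,
        map_zero]
      trivial
    · obtain ⟨h', hh'⟩ := hmove h
      obtain ⟨h₀, hh₀⟩ := hfix h
      rw [hh']
      rw [hh₀] at hP
      by_cases hx : x ∈ Set.range (algebraMap R L)
      · obtain ⟨a, b, rfl, rfl, hσa, hσb⟩ := hint h₀ hx
        have hns := (hns_iff h₀).mp hP
        have h'' : (W₀.baseChange L).toAffine.Nonsingular (algebraMap R L (σR a))
            (algebraMap R L (σR b)) := by rw [hσa, hσb]; exact h'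
        have key : W₀.HasNonsingularReduction (.some _ _ h'') := by
          rw [hns_iff h'']
          exact hσns_of hns
        have heq : (Affine.Point.some _ _ h' : (W₀.baseChange L).toAffine.Point) = .some _ _ h'' :=
          point_some_congr hσa.symm hσb.symm
        rw [heq]
        exact key
      · exact Or.inl (hnonint hx)
  refine ⟨σk, hσres, hstable, hx₀, hy₀, hα, ?_⟩
  -- `r = 0` on `E₁`
  have hzero : ∀ (Q : (W₀.baseChange L).toAffine.Point) (hQ : W₀.HasNonsingularReduction Q),
      W₀.ReducesToZero Q → r ⟨Q, hQ⟩ = 0 := fun Q hQ h0 ↦ (hr0 ⟨Q, hQ⟩).mpr h0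
  -- the value of `r` on a moved point (points generalized, so that `subst` applies)
  have key : ∀ (Q Qσ : (W₀.baseChange L).toAffine.Point) (hQ : W₀.HasNonsingularReduction Q)
      (hQσ : W₀.HasNonsingularReduction Qσ) (P : (X.baseChange L).toAffine.Point),
      Affine.Point.congrEquiv hX P = Q →
      Affine.Point.congrEquiv hX (σ • P) = Qσ →
        r ⟨Qσ, hQσ⟩ = σk (r ⟨Q, hQ⟩) := by
    intro Q Qσ hQ hQσ P hPQ hPQσ
    rcases P with _ | ⟨x, y, h⟩
    · -- `P = O`: both sides are `0`
      have hQ0 : Q = 0 := by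
        rw [← hPQ, show (Affine.Point.zero : (X.baseChange L).toAffine.Point) = 0 from rfl, map_zero]
      have hQσ0 : Qσ = 0 := by
        rw [← hPQσ, show (Affine.Point.zero : (X.baseChange L).toAffine.Point) = 0 from rfl,
          smul_zero, map_zero]
      subst hQ0
      subst hQσ0
      simp only [hzero 0 hQσ reducesToZero_zero, map_zero]
    · obtain ⟨h', hh'⟩ := hmove h
      obtain ⟨h₀, hh₀⟩ := hfix h
      rw [hh₀] at hPQ
      rw [hh'] at hPQσ
      subst hPQ
      subst hPQσ
      by_cases hx : x ∈ Set.range (algebraMap R L)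
      · -- integral point: `r (a, b) = cuspFun(ā, b̄)`, `r (σ a, σ b) = cuspFun(σ̄ ā, σ̄ b̄)`
        obtain ⟨a, b, rfl, rfl, hσa, hσb⟩ := hint h₀ hx
        have h'' : (W₀.baseChange L).toAffine.Nonsingular (algebraMap R L (σR a))
            (algebraMap R L (σR b)) := by rw [hσa, hσb]; exact h'
        have hQσ' : W₀.HasNonsingularReduction (.some _ _ h'') := by
          rw [← point_some_congr (h := h') (h' := h'') hσa.symm hσb.symm]
          exact hQσ
        have hns := (hns_iff h₀).mp hQ
        have hσns : (singularModel x₀ y₀ α α).toAffine.Nonsingular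
            (IsLocalRing.residue R (σR a)) (IsLocalRing.residue R (σR b)) := hσns_of hns
        have hrP : r ⟨.some _ _ h₀, hQ⟩ = singularModel.cuspFun x₀ y₀ α (.some _ _ hns) :=
          hr a b h₀ hns hQ
        have eQσ : (⟨.some (σ (algebraMap R L a)) (σ (algebraMap R L b)) h', hQσ⟩ :
            W₀.nonsingularReductionSubgroup hv) = ⟨.some _ _ h'', hQσ'⟩ :=
          Subtype.ext (point_some_congr hσa.symm hσb.symm)
        rw [eQσ, hrP, hr (σR a) (σR b) h'' hσns hQσ']
        simp only [singularModel.cuspFun, map_div₀, map_sub, map_mul, hσk, hx₀, hy₀, hα]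
      · -- a point of `E₁`: both sides are `0`
        have h0P : W₀.ReducesToZero (.some x y h₀) := (reducesToZero_some_iff h₀).mpr hx
        have h0σ : W₀.ReducesToZero (.some (σ x) (σ y) h') :=
          (reducesToZero_some_iff h').mpr (hnonint hx)
        simp only [hzero _ hQσ h0σ, hzero _ hQ h0P, map_zero]
  exact fun P hP hσP ↦ key _ _ hP hσP P rfl rfl

end Galois

end Summit.BirchSwinnertonDyer.Rank1Residual.X11b.Three.JetchevKummer

end
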